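import Mathlib
import Literature.Analysis.Matrix.TraceJensenInequality
import HarnessLib

/-!
# The key inequality behind Ball–Carlen–Lieb's optimal 2-uniform convexity of `S_p` (`1 < p ≤ 2`),
# real symmetric matrices

Sources: K. Ball, E. Carlen, E. H. Lieb, *Sharp uniform convexity and smoothness inequalities for trace
norms*, Invent. Math. 115 (1994) 463–482 [BallCarlenLieb1994], Thm. 1 (optimal 2-uniform convexity of the
Schatten classes `S_p`, `1 ≤ p ≤ 2`); É. Ricard, Q. Xu, *A noncommutative martingale convexity inequality*,
Ann. Probab. 44 (2016) 867–882 = arXiv:1405.0431 [RicardXu2016], §2, Lemma 5 (held text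
`paper:arxiv-1405.0431`, pp. 4–5 read first-hand) — the matrix-algebra case of the proof: the two-point
inequality is reduced to the second-order estimate
`(1/p) ‖a‖_p^{2-p} ψ''(0) ≥ (p-1) ‖b‖_p²`, `ψ(t) = Tr |a + t b|^p`, for an invertible self-adjoint `a`,
whose heart is the inequality (their (df1), with the |a|-reduction and the pinching/Hölder chain)
`ψ''(0) = Σ_{i,j} F_p(λ_i, λ_j) |b_{ij}|² ≥ p(p-1) ‖a‖_p^{p-2} ‖b‖_p²`
(`a = diag(λ)`, `F_p` the divided difference of `f_p'`, `f_p = |·|^p`); H. Zhang, *Optimal 2-uniform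
convexity of Schatten classes revisited*, arXiv:2011.00354 [Zhang2020Schatten], Lemma 2.2 (the termwise
reduction `F_p(λ_i,λ_j) ≥ F_p(|λ_i|,|λ_j|)`) and §3, (ineq:key) (held text `paper:arxiv-2011.00354`
pp. 4–6 read first-hand).

THIS FILE proves that KEY INEQUALITY for real symmetric matrices, in the coordinates of an eigenbasis of
`a` (`a = diag(λ)`, `λ_i ≠ 0`, `b` arbitrary real symmetric), with ONE scalar integral and otherwise
finite-dimensional algebra:

* `trAbsPow p M = Tr |M|^p = Σ_k |λ_k(M)|^p` (via Mathlib's `cfc`; the `p`-th power of the unnormalised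
  Schatten norm) and its eigenbasis bookkeeping (`trAbsPow_eq_sum`, diagonal matrices, `W diag(μ) Wᵀ`);
* the kernel `dd p x y = (f_p'(x) − f_p'(y))/(x − y)` (`= f_p''(x)` on the diagonal), `f_p' = p·x·|x|^{p−2}`;
  **(K0)** `dd p |x| |y| ≤ dd p x y` [Zhang2020Schatten, Lemma 2.2 (2)] (`dd_abs_le`);
  **(K1)** the Hermite–Hadamard bound `p(p−1)((x+y)/2)^{p−2} ≤ dd p x y` for `x, y > 0` (`hh_dd`; the
  divided difference of `x^{p−1}` is the mean of its derivative over `[y,x]`, which dominates the value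
  at the midpoint by convexity of `x^{p−2}` — proved here directly, [folklore]);
* **(K2)** the compression step, `Σ_{ij} ((λ_i+λ_j)/2)^{p−2} b_{ij}² ≥ Σ_k ã_k^{p−2} μ_k²` where
  `b = W diag(μ) Wᵀ` is the spectral decomposition of `b` and `ã_k = (Wᵀ a W)_{kk}` the diagonal of `a` in
  the eigenbasis of `b` (`compress_rpow`): the Stieltjes representation
  `x^{−β} = C_β⁻¹ ∫_0^∞ s^{−β} (x+s)⁻¹ ds` (`0 < β < 1`; `integral_kernel`, one substitution) reduces it
  to the pointwise inequality `Σ_{ij} b_{ij}²/((λ_i+λ_j)/2 + s) ≥ Σ_k μ_k²/(ã_k + s)` (`resolvent_compress`: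
  "the compression of an inverse dominates the inverse of the compression", for the arithmetic-mean
  multiplication operator `Z ↦ (aZ + Za)/2 + sZ` compressed to `span{w_k w_kᵀ}`, on which it is diagonal
  with entries `ã_k + s`; a completion of squares) — this replaces the convexity/Kadison–Schwarz/
  operator-convexity chain of [RicardXu2016, proof of Lemma 5] by its variational core;
* **(K3)** Hölder with exponents `2/p`, `2/(2−p)` and the Peierls–Jensen bound `Σ_k ã_k^p ≤ Σ_i |λ_i|^p`
  (tree: `Literature.Analysis.Matrix.TraceJensen.sum_peierls_jensen_le`);
* **`key_inequality`**: for `1 < p < 2`, `λ_i ≠ 0`, `b` real symmetric,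
  `p(p−1) (Σ_i |λ_i|^p)^{(p−2)/p} (Tr|b|^p)^{2/p} ≤ Σ_{i,j} dd p λ_i λ_j · b_{ij}²`
  [RicardXu2016, Lemma 5, (df1)] [Zhang2020Schatten, §3 (ineq:key)].

The local second-order expansion, the globalisation and the two-point inequality itself are in the sibling
files `BallCarlenLiebLocal.lean` / `BallCarlenLieb.lean`. Consumer: the cell pnp-psdrank's named fact
`Literature.Computability.Complexity.MatrixHypercontractivity.BenAroyaRegevDeWolf2008_thm1`, which is
kernel-equivalent to the two-point inequality (`BenAroyaRegevDeWolf2008_thm1_iff_twoPoint`).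
Everything here is PROVED; no named facts, no instances, no notation. WHAT THIS IS NOT: not yet the
two-point inequality; nothing about psd rank or P vs NP.
-/

noncomputable section

open Real Set MeasureTheory Matrix Finset

namespace Literature.Analysis.Matrix.BallCarlenLieb


/-- `f_p'(x) = p·x·|x|^{p-2}`, the derivative of `f_p = |·|^p` (`1 < p`).
[cite: Zhang2020Schatten, Lemma 2.2 (proof: `f_p'(r) = p|r|^{p-1} sgn(r)`)] -/
def dabs (p x : ℝ) : ℝ := p * x * |x| ^ (p - 2)

/-- The second-order kernel of `f_p = |·|^p`: the divided difference `(f_p'(x) - f_p'(y))/(x-y)` of `f_p'`,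
and `f_p''(x) = p(p-1)|x|^{p-2}` on the diagonal (`= f_p^{[2]}(x,y,x) + f_p^{[2]}(y,x,y)` of the source).
[cite: Zhang2020Schatten, Lemma 2.2 and eq. (eq:r,s)] -/
def dd (p x y : ℝ) : ℝ :=
  if x = y then p * (p - 1) * |x| ^ (p - 2) else (dabs p x - dabs p y) / (x - y)

/-- `dd` is symmetric. [cite: Zhang2020Schatten, Lemma 2.2] -/
theorem dd_comm (p x y : ℝ) : dd p x y = dd p y x := by
  unfold dd
  by_cases h : x = y
  · subst h; rfl
  · rw [if_neg h, if_neg (Ne.symm h), div_eq_div_iff (sub_ne_zero.2 h) (sub_ne_zero.2 (Ne.symm h))]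
    ring

/-- `f_p'(x) = p x^{p-1}` for `x > 0`. [cite: Zhang2020Schatten, Lemma 2.2 (proof)] -/
theorem dabs_of_pos {p x : ℝ} (hx : 0 < x) : dabs p x = p * x ^ (p - 1) := by
  unfold dabs
  rw [abs_of_pos hx, show p - 1 = p - 2 + 1 by ring, Real.rpow_add_one hx.ne']
  ring

/-- `f_p'` is odd. [cite: Zhang2020Schatten, Lemma 2.2 (proof)] -/
theorem dabs_neg (p x : ℝ) : dabs p (-x) = -dabs p x := by
  unfold dabs; rw [abs_neg]; ring

/-- Zhang's inequality: for `r, s > 0`, `r ≠ s`, `α ≤ 1`: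
`(r^α - s^α)/(r - s) ≤ (r^α + s^α)/(r + s)` ("trivial, since `x ↦ x^{2-p}` is non-decreasing").
[cite: Zhang2020Schatten, Lemma 2.2 (2), proof] -/
theorem divDiff_le_sumQuot {α r s : ℝ} (hα1 : α ≤ 1) (hr : 0 < r) (hs : 0 < s)
    (hrs : r ≠ s) : (r ^ α - s ^ α) / (r - s) ≤ (r ^ α + s ^ α) / (r + s) := by
  -- WLOG s < r
  wlog hlt : s < r generalizing r s
  · have hlt' : r < s := lt_of_le_of_ne (not_lt.1 hlt) hrs
    have h := this hs hr (Ne.symm hrs) hlt'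
    have e : (s ^ α - r ^ α) / (s - r) = (r ^ α - s ^ α) / (r - s) := by
      rw [← neg_sub (r ^ α) (s ^ α), ← neg_sub r s, neg_div_neg_eq]
    rwa [e, add_comm (s ^ α), add_comm s] at h
  have hrs' : 0 < r - s := sub_pos.2 hlt
  have hsum : 0 < r + s := by positivity
  rw [div_le_div_iff₀ hrs' hsum]
  -- reduces to s r^α ≤ r s^α, i.e. (r/s)^α ≤ r/s
  have key : s * r ^ α ≤ r * s ^ α := by
    have ht : 1 ≤ r / s := (one_le_div hs).2 hlt.le
    have h1 : (r / s) ^ α ≤ (r / s) ^ (1 : ℝ) := Real.rpow_le_rpow_of_exponent_le ht hα1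
    rw [Real.rpow_one, Real.div_rpow hr.le hs.le, div_le_div_iff₀ (Real.rpow_pos_of_pos hs α) hs] at h1
    linarith [h1]
  nlinarith [key, Real.rpow_pos_of_pos hr α, Real.rpow_pos_of_pos hs α]

/-- The auxiliary inequality of the Hermite–Hadamard step: `2αδ ≤ (1+δ)^α − (1−δ)^α` for `0 < α ≤ 1`,
`0 ≤ δ < 1` (the derivative `α((1+δ)^{α-1} + (1−δ)^{α-1}) − 2α` is nonnegative by AM–GM). [folklore] -/
private theorem hh_aux {α δ : ℝ} (hα0 : 0 < α) (hα1 : α ≤ 1) (hδ0 : 0 ≤ δ) (hδ1 : δ < 1) :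
    2 * α * δ ≤ (1 + δ) ^ α - (1 - δ) ^ α := by
  -- g(δ) = (1+δ)^α - (1-δ)^α - 2αδ is nondecreasing on [0, δ] since g' ≥ 0
  have hderiv : ∀ t ∈ Set.Ioo (-1 : ℝ) 1, HasDerivAt (fun t : ℝ => (1 + t) ^ α - (1 - t) ^ α - 2 * α * t)
      (α * (1 + t) ^ (α - 1) + α * (1 - t) ^ (α - 1) - 2 * α) t := by
    intro t ht
    have hp : (0 : ℝ) < 1 + t := by linarith [ht.1]
    have hm : (0 : ℝ) < 1 - t := by linarith [ht.2]
    have h1 : HasDerivAt (fun t : ℝ => (1 + t) ^ α) (α * (1 + t) ^ (α - 1)) t := by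
      have h := ((hasDerivAt_id t).const_add 1).rpow_const (p := α) (Or.inl hp.ne')
      simpa using h
    have h2 : HasDerivAt (fun t : ℝ => (1 - t) ^ α) (-(α * (1 - t) ^ (α - 1))) t := by
      have h := ((hasDerivAt_id t).const_sub 1).rpow_const (p := α) (Or.inl hm.ne')
      simpa using h
    have h3 : HasDerivAt (fun t : ℝ => 2 * α * t) (2 * α) t := by
      simpa using (hasDerivAt_id t).const_mul (2 * α)
    refine ((h1.sub h2).sub h3).congr_deriv ?_
    ring
  have hderiv_nonneg : ∀ t ∈ Set.Ioo (-1 : ℝ) 1,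
      0 ≤ α * (1 + t) ^ (α - 1) + α * (1 - t) ^ (α - 1) - 2 * α := by
    intro t ht
    have hp : 0 < 1 + t := by linarith [ht.1]
    have hm : 0 < 1 - t := by linarith [ht.2]
    set u := (1 + t) ^ ((α - 1) / 2) with hu
    set v := (1 - t) ^ ((α - 1) / 2) with hv
    have hu2 : u ^ 2 = (1 + t) ^ (α - 1) := by
      rw [hu, ← Real.rpow_natCast, ← Real.rpow_mul hp.le]; norm_num
    have hv2 : v ^ 2 = (1 - t) ^ (α - 1) := by
      rw [hv, ← Real.rpow_natCast, ← Real.rpow_mul hm.le]; norm_num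
    have huv : 1 ≤ u * v := by
      rw [hu, hv, ← Real.mul_rpow hp.le hm.le]
      exact Real.one_le_rpow_of_pos_of_le_one_of_nonpos (by positivity)
        (by nlinarith [sq_nonneg t]) (by linarith)
    have hamgm := two_mul_le_add_sq u v
    rw [← hu2, ← hv2]
    nlinarith
  have hmono : MonotoneOn (fun t : ℝ => (1 + t) ^ α - (1 - t) ^ α - 2 * α * t) (Set.Icc 0 δ) := by
    have hcont : ContinuousOn (fun t : ℝ => (1 + t) ^ α - (1 - t) ^ α - 2 * α * t) (Set.Icc 0 δ) := by
      intro t ht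
      exact (hderiv t ⟨by linarith [ht.1], by linarith [ht.2]⟩).continuousAt.continuousWithinAt
    refine monotoneOn_of_deriv_nonneg (convex_Icc 0 δ) hcont ?_ ?_
    · intro t ht
      rw [interior_Icc] at ht
      exact (hderiv t ⟨by linarith [ht.1], by linarith [ht.2]⟩).differentiableAt.differentiableWithinAt
    · intro t ht
      rw [interior_Icc] at ht
      rw [(hderiv t ⟨by linarith [ht.1], by linarith [ht.2]⟩).deriv]
      exact hderiv_nonneg t ⟨by linarith [ht.1], by linarith [ht.2]⟩
  have := hmono (left_mem_Icc.2 hδ0) (right_mem_Icc.2 hδ0) hδ0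
  simp only [add_zero, sub_zero, Real.one_rpow, sub_self, mul_zero] at this
  linarith

/-- Hermite–Hadamard for the divided difference of `x^α` (`0 < α ≤ 1`; `x^{α-1}` is convex): for `r, s > 0`,
`r ≠ s`, [folklore]
`α ((r+s)/2)^{α-1} ≤ (r^α - s^α)/(r - s)`. -/
private theorem hh_divDiff {α r s : ℝ} (hα0 : 0 < α) (hα1 : α ≤ 1) (hr : 0 < r) (hs : 0 < s) (hrs : r ≠ s) :
    α * ((r + s) / 2) ^ (α - 1) ≤ (r ^ α - s ^ α) / (r - s) := by
  wlog hlt : s < r generalizing r s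
  · have hlt' : r < s := lt_of_le_of_ne (not_lt.1 hlt) hrs
    have h := this hs hr (Ne.symm hrs) hlt'
    have e : (s ^ α - r ^ α) / (s - r) = (r ^ α - s ^ α) / (r - s) := by
      rw [← neg_sub (r ^ α) (s ^ α), ← neg_sub r s, neg_div_neg_eq]
    rwa [e, add_comm s r] at h
  set m := (r + s) / 2 with hm
  have hm0 : 0 < m := by positivity
  set δ := (r - s) / (r + s) with hδ
  have hsum : 0 < r + s := by positivity
  have hδ0 : 0 ≤ δ := div_nonneg (by linarith) hsum.le
  have hδ1 : δ < 1 := (div_lt_one hsum).2 (by linarith)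
  have hr' : r = m * (1 + δ) := by rw [hm, hδ]; field_simp; ring
  have hs' : s = m * (1 - δ) := by rw [hm, hδ]; field_simp; ring
  have haux := hh_aux hα0 hα1 hδ0 hδ1
  have hrs' : 0 < r - s := by linarith
  rw [le_div_iff₀ hrs']
  have e1 : r ^ α = m ^ α * (1 + δ) ^ α := by rw [hr', Real.mul_rpow hm0.le (by linarith)]
  have e2 : s ^ α = m ^ α * (1 - δ) ^ α := by rw [hs', Real.mul_rpow hm0.le (by linarith)]
  have e3 : r - s = m * (2 * δ) := by rw [hr', hs']; ring
  have e4 : m ^ (α - 1) * m = m ^ α := by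
    rw [show α = α - 1 + 1 by ring, Real.rpow_add_one hm0.ne' (α - 1)]; ring_nf
  rw [e1, e2, e3, ← mul_sub]
  calc α * m ^ (α - 1) * (m * (2 * δ)) = m ^ (α - 1) * m * (2 * α * δ) := by ring
    _ = m ^ α * (2 * α * δ) := by rw [e4]
    _ ≤ m ^ α * ((1 + δ) ^ α - (1 - δ) ^ α) :=
        mul_le_mul_of_nonneg_left haux (Real.rpow_nonneg hm0.le α)

/-- **(K1)** For `x, y > 0` and `1 < p ≤ 2`: `p(p-1)((x+y)/2)^{p-2} ≤ dd p x y` (Hermite–Hadamard).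
[folklore] [cite: Zhang2020Schatten, eq. (eq:F_p) (the kernel `F_p(r,s) = p(r^{p-1}-s^{p-1})/(r-s)`)] -/
theorem hh_dd {p x y : ℝ} (hp1 : 1 < p) (hp2 : p ≤ 2) (hx : 0 < x) (hy : 0 < y) :
    p * (p - 1) * ((x + y) / 2) ^ (p - 2) ≤ dd p x y := by
  unfold dd
  by_cases h : x = y
  · subst h; rw [if_pos rfl, abs_of_pos hx, show (x + x) / 2 = x by ring]
  · rw [if_neg h, dabs_of_pos hx, dabs_of_pos hy, ← mul_sub, mul_div_assoc]
    have hh := hh_divDiff (α := p - 1) (by linarith) (by linarith) hx hy h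
    have e : p - 1 - 1 = p - 2 := by ring
    rw [e] at hh
    have hp0 : 0 ≤ p := by linarith
    calc p * (p - 1) * ((x + y) / 2) ^ (p - 2) = p * ((p - 1) * ((x + y) / 2) ^ (p - 2)) := by ring
      _ ≤ p * ((x ^ (p - 1) - y ^ (p - 1)) / (x - y)) := mul_le_mul_of_nonneg_left hh hp0

/-- `dd p (-x) (-y) = dd p x y`. [cite: Zhang2020Schatten, Lemma 2.2 (1)] -/
theorem dd_neg_neg (p x y : ℝ) : dd p (-x) (-y) = dd p x y := by
  unfold dd
  by_cases h : x = y
  · subst h; simp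
  · rw [if_neg (fun h' => h (neg_inj.1 h')), if_neg h, dabs_neg, dabs_neg,
      show -dabs p x - -dabs p y = -(dabs p x - dabs p y) by ring,
      show -x - -y = -(x - y) by ring, neg_div_neg_eq]

/-- **(K0)** For `x, y ≠ 0` and `1 < p ≤ 2`: `dd p |x| |y| ≤ dd p x y` — the kernel does not increase when
`a` is replaced by `|a|`. [cite: Zhang2020Schatten, Lemma 2.2 (2)] -/
theorem dd_abs_le {p x y : ℝ} (hp1 : 1 < p) (hp2 : p ≤ 2) (hx : x ≠ 0) (hy : y ≠ 0) :
    dd p |x| |y| ≤ dd p x y := by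
  have hp0 : 0 < p := by linarith
  wlog hxpos : 0 < x generalizing x y
  · have hx' : 0 < -x := by
      rcases lt_trichotomy x 0 with h | h | h
      · linarith
      · exact absurd h hx
      · exact absurd h hxpos
    have h := this (neg_ne_zero.2 hx) (neg_ne_zero.2 hy) hx'
    rwa [abs_neg, abs_neg, dd_neg_neg] at h
  rw [abs_of_pos hxpos]
  rcases lt_trichotomy y 0 with hyneg | h0 | hypos
  · -- mixed signs: y = -s with s > 0
    obtain ⟨s, rfl⟩ : ∃ s, y = -s := ⟨-y, (neg_neg y).symm⟩
    have hs0 : 0 < s := by linarith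
    rw [abs_neg, abs_of_pos hs0]
    have hne : x ≠ -s := by intro h'; linarith
    unfold dd
    rw [if_neg hne, dabs_neg, dabs_of_pos hxpos, dabs_of_pos hs0, sub_neg_eq_add, sub_neg_eq_add]
    by_cases hxs : x = s
    · subst hxs
      rw [if_pos rfl, abs_of_pos hxpos]
      have e : (p * x ^ (p - 1) + p * x ^ (p - 1)) / (x + x) = p * x ^ (p - 2) := by
        rw [show p - 1 = p - 2 + 1 by ring, Real.rpow_add_one hxpos.ne' (p - 2)]
        field_simp
      rw [e]
      have h2 : 0 ≤ p * x ^ (p - 2) := by positivity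
      nlinarith
    · rw [if_neg hxs, ← mul_sub, ← mul_add, mul_div_assoc, mul_div_assoc]
      exact mul_le_mul_of_nonneg_left
        (divDiff_le_sumQuot (α := p - 1) (by linarith) hxpos hs0 hxs) hp0.le
  · exact absurd h0 hy
  · rw [abs_of_pos hypos]



/-- The Stieltjes constant `C_β = ∫_0^∞ u^{-β}/(1+u) du` (`= π/sin(πβ)`, value not needed).
[cite: RicardXu2016, proof of Lemma 5 (the constants `c_p`, `d_p` of the integral representations)] -/
def stC (β : ℝ) : ℝ := ∫ u in Set.Ioi (0:ℝ), u ^ (-β) / (1 + u)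

/-- Continuity of `s ↦ s^{-β}/(x+s)` on `(0,∞)`. [cite: RicardXu2016, proof of Lemma 5 (integral representation)] -/
theorem continuousOn_kernel (β x : ℝ) (hx : 0 < x) :
    ContinuousOn (fun s : ℝ => s ^ (-β) / (x + s)) (Set.Ioi 0) := by
  intro s hs
  have hs' : (0:ℝ) < s := hs
  refine ContinuousAt.continuousWithinAt ?_
  refine ContinuousAt.div ?_ (by fun_prop) (by linarith)
  exact ContinuousAt.rpow_const continuousAt_id (Or.inl hs'.ne')

/-- Integrability of `s ↦ s^{-β}/(x+s)` on `(0,∞)` for `0 < β < 1`, `x > 0` (dominated by `x⁻¹ s^{-β}` near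
`0` and by `s^{-β-1}` at infinity). [cite: RicardXu2016, proof of Lemma 5 (integral representation)] -/
theorem integrableOn_kernel {β x : ℝ} (hβ0 : 0 < β) (hβ1 : β < 1) (hx : 0 < x) :
    IntegrableOn (fun s : ℝ => s ^ (-β) / (x + s)) (Set.Ioi 0) := by
  have hsplit : Set.Ioi (0:ℝ) = Set.Ioc 0 1 ∪ Set.Ioi 1 := by
    rw [Ioc_union_Ioi_eq_Ioi zero_le_one]
  rw [hsplit]
  refine IntegrableOn.union ?_ ?_
  · -- on (0,1]: dominated by x⁻¹ s^{-β}
    have h1 : IntegrableOn (fun s : ℝ => s ^ (-β)) (Set.Ioc 0 1) := by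
      have := intervalIntegral.intervalIntegrable_rpow' (a := 0) (b := 1) (r := -β) (by linarith)
      exact (intervalIntegrable_iff_integrableOn_Ioc_of_le zero_le_one).1 this
    have hmeas : AEStronglyMeasurable (fun s : ℝ => s ^ (-β) / (x + s))
        (volume.restrict (Set.Ioc 0 1)) := by
      refine ContinuousOn.aestronglyMeasurable ?_ measurableSet_Ioc
      exact (continuousOn_kernel β x hx).mono Ioc_subset_Ioi_self
    refine Integrable.mono' (h1.const_mul x⁻¹) hmeas ?_
    refine (ae_restrict_iff' measurableSet_Ioc).2 (Filter.Eventually.of_forall fun s hs => ?_)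
    have hs0 : 0 < s := hs.1
    have hxs : 0 < x + s := by linarith
    rw [Real.norm_eq_abs, abs_of_nonneg (div_nonneg (Real.rpow_nonneg hs0.le _) hxs.le),
      div_eq_mul_inv, mul_comm (x⁻¹)]
    refine mul_le_mul_of_nonneg_left ?_ (Real.rpow_nonneg hs0.le _)
    exact inv_anti₀ hx (by linarith)
  · -- on (1,∞): dominated by s^{-β-1}
    have h2 : IntegrableOn (fun s : ℝ => s ^ (-β - 1)) (Set.Ioi 1) :=
      integrableOn_Ioi_rpow_of_lt (by linarith) one_pos
    have hmeas : AEStronglyMeasurable (fun s : ℝ => s ^ (-β) / (x + s))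
        (volume.restrict (Set.Ioi 1)) := by
      refine ContinuousOn.aestronglyMeasurable ?_ measurableSet_Ioi
      exact (continuousOn_kernel β x hx).mono (Ioi_subset_Ioi zero_le_one)
    refine Integrable.mono' h2 hmeas ?_
    refine (ae_restrict_iff' measurableSet_Ioi).2 (Filter.Eventually.of_forall fun s hs => ?_)
    have hs1 : (1:ℝ) < s := hs
    have hs0 : 0 < s := by linarith
    have hxs : 0 < x + s := by linarith
    rw [Real.norm_eq_abs, abs_of_nonneg (div_nonneg (Real.rpow_nonneg hs0.le _) hxs.le),
      show -β - 1 = -β + (-1) by ring, Real.rpow_add hs0, Real.rpow_neg_one, div_eq_mul_inv]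
    refine mul_le_mul_of_nonneg_left ?_ (Real.rpow_nonneg hs0.le _)
    exact inv_anti₀ hs0 (by linarith)

/-- **Stieltjes representation of `x^{-β}`** (substitution `s = xu`): `∫_0^∞ s^{-β}/(x+s) ds = x^{-β} C_β` for
`x > 0`. [cite: RicardXu2016, proof of Lemma 5 (the integral representation of `(a+tb)^{p-1}`)] -/
theorem integral_kernel {β x : ℝ} (hx : 0 < x) :
    ∫ s in Set.Ioi (0:ℝ), s ^ (-β) / (x + s) = x ^ (-β) * stC β := by
  have hsub := integral_comp_mul_left_Ioi (fun s : ℝ => s ^ (-β) / (x + s)) 0 hx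
  rw [mul_zero] at hsub
  -- rewrite the integrand on the left
  have hcongr : ∫ u in Set.Ioi (0:ℝ), (x * u) ^ (-β) / (x + x * u) =
      ∫ u in Set.Ioi (0:ℝ), (x ^ (-β) * x⁻¹) * (u ^ (-β) / (1 + u)) := by
    refine setIntegral_congr_fun measurableSet_Ioi fun u hu => ?_
    have hu0 : (0:ℝ) < u := hu
    rw [Real.mul_rpow hx.le hu0.le, show x + x * u = x * (1 + u) by ring]
    field_simp
  rw [hcongr, integral_const_mul] at hsub
  -- hsub : x^{-β} x⁻¹ C = x⁻¹ • ∫ ...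
  rw [smul_eq_mul] at hsub
  have hx0 : x⁻¹ ≠ 0 := inv_ne_zero hx.ne'
  have : x⁻¹ * (x ^ (-β) * stC β) = x⁻¹ * ∫ s in Set.Ioi (0:ℝ), s ^ (-β) / (x + s) := by
    rw [← hsub]; unfold stC; ring
  exact (mul_left_cancel₀ hx0 this).symm

/-- `C_β > 0` for `0 < β < 1`. [cite: RicardXu2016, proof of Lemma 5 (integral representation)] -/
theorem stC_pos {β : ℝ} (hβ0 : 0 < β) (hβ1 : β < 1) : 0 < stC β := by
  unfold stC
  have hint : IntegrableOn (fun s : ℝ => s ^ (-β) / (1 + s)) (Set.Ioi 0) := integrableOn_kernel hβ0 hβ1 one_pos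
  have hnn : 0 ≤ᵐ[volume.restrict (Set.Ioi (0:ℝ))] fun s : ℝ => s ^ (-β) / (1 + s) := by
    refine (ae_restrict_iff' measurableSet_Ioi).2 (Filter.Eventually.of_forall fun s hs => ?_)
    have hs0 : (0:ℝ) < s := hs
    exact div_nonneg (Real.rpow_nonneg hs0.le _) (by linarith)
  rw [setIntegral_pos_iff_support_of_nonneg_ae hnn hint]
  have hsub : Set.Ioi (0:ℝ) ⊆ Function.support (fun s : ℝ => s ^ (-β) / (1 + s)) ∩ Set.Ioi 0 := by
    intro s hs
    have hs0 : (0:ℝ) < s := hs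
    refine ⟨?_, hs⟩
    rw [Function.mem_support]
    exact (div_pos (Real.rpow_pos_of_pos hs0 _) (by linarith)).ne'
  exact lt_of_lt_of_le (by simp [Real.volume_Ioi]) (measure_mono hsub)



variable {n : Type*} [Fintype n] [DecidableEq n]

/-- `W diag(μ) Wᵀ` (a symmetric matrix with prescribed eigenbasis). [folklore] -/
def conjDiag (W : Matrix n n ℝ) (μ : n → ℝ) : Matrix n n ℝ := W * diagonal μ * Wᵀ

/-- The diagonal of `diag(λ)` seen from the basis `W`: `ã_k = Σ_i W_ik² λ_i = (Wᵀ diag(λ) W)_kk` — the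
pinching `𝓔_b(a)` of the source in coordinates. [cite: RicardXu2016, proof of Lemma 5 (ã = 𝓔_b(a))] -/
def avgDiag (W : Matrix n n ℝ) (lam : n → ℝ) (k : n) : ℝ := ∑ i, W i k ^ 2 * lam i

/-- Entries of `W diag(μ) Wᵀ`. [folklore] -/
private theorem conjDiag_apply (W : Matrix n n ℝ) (μ : n → ℝ) (i j : n) :
    conjDiag W μ i j = ∑ k, W i k * μ k * W j k := by
  unfold conjDiag
  rw [mul_apply]
  refine sum_congr rfl fun k _ => ?_
  rw [mul_diagonal, transpose_apply]

/-- `W diag(μ) Wᵀ` is symmetric. [folklore] -/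
private theorem conjDiag_transpose (W : Matrix n n ℝ) (μ : n → ℝ) : (conjDiag W μ)ᵀ = conjDiag W μ := by
  unfold conjDiag
  rw [transpose_mul, transpose_mul, transpose_transpose, diagonal_transpose, Matrix.mul_assoc]

/-- Columns of `W` are unit vectors when `Wᵀ W = 1`. [folklore] -/
private theorem col_sum_sq_eq_one {W : Matrix n n ℝ} (hW : Wᵀ * W = 1) (k : n) : ∑ i, W i k ^ 2 = 1 := by
  have h := congrFun (congrFun hW k) k
  rw [mul_apply, one_apply_eq] at h
  simpa [transpose_apply, sq] using h

/-- `(W diag μ Wᵀ)(W diag ν Wᵀ) = W diag(μν) Wᵀ` when `Wᵀ W = 1`. [folklore] -/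
private theorem conjDiag_mul_conjDiag {W : Matrix n n ℝ} (hW : Wᵀ * W = 1) (μ ν : n → ℝ) :
    conjDiag W μ * conjDiag W ν = conjDiag W (fun k => μ k * ν k) := by
  unfold conjDiag
  calc W * diagonal μ * Wᵀ * (W * diagonal ν * Wᵀ)
      = W * diagonal μ * (Wᵀ * W) * diagonal ν * Wᵀ := by simp only [Matrix.mul_assoc]
    _ = W * diagonal (fun k => μ k * ν k) * Wᵀ := by
        rw [hW, Matrix.mul_one, Matrix.mul_assoc W, diagonal_mul_diagonal]

/-- `Tr (W diag μ Wᵀ) = Σ μ` when `Wᵀ W = 1`. [folklore] -/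
private theorem trace_conjDiag {W : Matrix n n ℝ} (hW : Wᵀ * W = 1) (μ : n → ℝ) :
    trace (conjDiag W μ) = ∑ k, μ k := by
  unfold conjDiag
  rw [Matrix.mul_assoc, trace_mul_comm, Matrix.mul_assoc, hW, Matrix.mul_one, trace_diagonal]

/-- `Σ_ij b_ij Z_ij = Σ_k μ_k z_k` for co-diagonal `b = W diag μ Wᵀ`, `Z = W diag z Wᵀ`. [folklore] -/
private theorem sum_conjDiag_mul_conjDiag {W : Matrix n n ℝ} (hW : Wᵀ * W = 1) (μ z : n → ℝ) :
    ∑ i, ∑ j, conjDiag W μ i j * conjDiag W z i j = ∑ k, μ k * z k := by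
  have h : ∑ i, ∑ j, conjDiag W μ i j * conjDiag W z i j = trace (conjDiag W μ * conjDiag W z) := by
    rw [trace]
    simp only [diag_apply, mul_apply]
    refine sum_congr rfl fun i _ => sum_congr rfl fun j _ => ?_
    rw [← conjDiag_transpose W z, transpose_apply, conjDiag_transpose]
  rw [h, conjDiag_mul_conjDiag hW, trace_conjDiag hW]

/-- `(W diag(ν) Wᵀ)_ii = Σ_k W_ik² ν_k`. [folklore] -/
private theorem conjDiag_apply_self (W : Matrix n n ℝ) (ν : n → ℝ) (i : n) :
    conjDiag W ν i i = ∑ k, W i k ^ 2 * ν k := by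
  rw [conjDiag_apply]
  refine sum_congr rfl fun k _ => ?_
  ring

/-- `Σ_ij (λ_i + s) Z_ij² = Σ_k (ã_k + s) z_k²` for `Z = W diag(z) Wᵀ`, `Wᵀ W = 1` (the quadratic form of the
multiplication operator on the compression). [folklore] -/
private theorem sum_weight_conjDiag_sq {W : Matrix n n ℝ} (hW : Wᵀ * W = 1) (lam z : n → ℝ) (s : ℝ) :
    ∑ i, ∑ j, (lam i + s) * conjDiag W z i j ^ 2 = ∑ k, (avgDiag W lam k + s) * z k ^ 2 := by
  have h1 : ∀ i, ∑ j, conjDiag W z i j ^ 2 = conjDiag W (fun k => z k * z k) i i := by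
    intro i
    rw [← conjDiag_mul_conjDiag hW, mul_apply]
    refine sum_congr rfl fun j _ => ?_
    rw [sq, ← conjDiag_transpose W z, transpose_apply, conjDiag_transpose]
  calc ∑ i, ∑ j, (lam i + s) * conjDiag W z i j ^ 2
      = ∑ i, (lam i + s) * conjDiag W (fun k => z k * z k) i i := by
        refine sum_congr rfl fun i _ => ?_
        rw [← mul_sum, h1]
    _ = ∑ i, ∑ k, (lam i + s) * (W i k ^ 2 * (z k * z k)) := by
        refine sum_congr rfl fun i _ => ?_
        rw [conjDiag_apply_self, mul_sum]
    _ = ∑ k, ∑ i, (lam i + s) * (W i k ^ 2 * (z k * z k)) := sum_comm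
    _ = ∑ k, (avgDiag W lam k + s) * z k ^ 2 := by
        refine sum_congr rfl fun k _ => ?_
        unfold avgDiag
        have hc := col_sum_sq_eq_one hW k
        calc ∑ i, (lam i + s) * (W i k ^ 2 * (z k * z k))
            = (∑ i, W i k ^ 2 * lam i + s * ∑ i, W i k ^ 2) * z k ^ 2 := by
              rw [mul_sum, ← sum_add_distrib, sum_mul]
              refine sum_congr rfl fun i _ => ?_; ring
          _ = (∑ i, W i k ^ 2 * lam i + s) * z k ^ 2 := by rw [hc, mul_one]

/-- `ã_k > 0` when all `λ_i > 0` (`Wᵀ W = 1`). [folklore] -/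
private theorem avgDiag_pos {W : Matrix n n ℝ} (hW : Wᵀ * W = 1) {lam : n → ℝ} (hlam : ∀ i, 0 < lam i)
    (k : n) : 0 < avgDiag W lam k := by
  unfold avgDiag
  have hne : (univ : Finset n).Nonempty := ⟨k, mem_univ k⟩
  obtain ⟨i₀, -, hi₀⟩ := exists_min_image univ lam hne
  have h1 := col_sum_sq_eq_one hW k
  calc (0 : ℝ) < lam i₀ * ∑ i, W i k ^ 2 := by rw [h1, mul_one]; exact hlam i₀
    _ = ∑ i, W i k ^ 2 * lam i₀ := by rw [mul_sum]; refine sum_congr rfl fun i _ => ?_; ring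
    _ ≤ ∑ i, W i k ^ 2 * lam i :=
        sum_le_sum fun i _ => mul_le_mul_of_nonneg_left (hi₀ i (mem_univ i)) (sq_nonneg _)

/-- **Pointwise resolvent compression inequality** `R(s)`:
`Σ_k μ_k²/(ã_k + s) ≤ Σ_ij b_ij²/((λ_i+λ_j)/2 + s)` (`b = W diag(μ) Wᵀ`, `ã_k = Σ_i W_ik² λ_i`, `λ > 0`,
`s ≥ 0`): with `T(Z) = (aZ + Za)/2 + sZ` (positive on symmetric matrices, diagonal in the basis `E_ij` of
`a`'s eigenbasis with entries `(λ_i+λ_j)/2+s`), `⟨b, T⁻¹ b⟩ ≥ 2⟨b, Z⟩ − ⟨Z, T Z⟩` for every `Z`, applied to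
`Z = W diag(μ_k/(ã_k+s)) Wᵀ` — the variational core of the chain "convexity of `z ↦ τ[(s+z)⁻¹b(s+z)⁻¹b]`,
Kadison–Schwarz for `𝓔_b`, operator convexity of `1/t`" of the source.
[cite: RicardXu2016, proof of Lemma 5 (from `F(z) ≥ F(z')` to eq. (df2))] -/
theorem resolvent_compress {W : Matrix n n ℝ} (hW : Wᵀ * W = 1) {lam : n → ℝ}
    (hlam : ∀ i, 0 < lam i) (μ : n → ℝ) {s : ℝ} (hs : 0 ≤ s) :
    ∑ k, μ k ^ 2 / (avgDiag W lam k + s) ≤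
      ∑ i, ∑ j, conjDiag W μ i j ^ 2 / ((lam i + lam j) / 2 + s) := by
  obtain ⟨c, hc⟩ : ∃ c : n → ℝ, ∀ k, c k = avgDiag W lam k + s := ⟨_, fun k => rfl⟩
  have hcpos : ∀ k, 0 < c k := fun k => by
    rw [hc]; exact add_pos_of_pos_of_nonneg (avgDiag_pos hW hlam k) hs
  obtain ⟨z, hz⟩ : ∃ z : n → ℝ, ∀ k, z k = μ k / c k := ⟨_, fun k => rfl⟩
  have hm : ∀ i j, 0 < (lam i + lam j) / 2 + s := fun i j => by
    have := hlam i; have := hlam j; positivity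
  -- 0 ≤ Σ (m+s)(b/(m+s) - Z)² = Σ b²/(m+s) - 2 Σ bZ + Σ (m+s) Z²
  have hpos : 0 ≤ ∑ i, ∑ j, ((lam i + lam j) / 2 + s) *
      (conjDiag W μ i j / ((lam i + lam j) / 2 + s) - conjDiag W z i j) ^ 2 :=
    sum_nonneg fun i _ => sum_nonneg fun j _ => mul_nonneg (hm i j).le (sq_nonneg _)
  have hexp : ∑ i, ∑ j, ((lam i + lam j) / 2 + s) *
      (conjDiag W μ i j / ((lam i + lam j) / 2 + s) - conjDiag W z i j) ^ 2 =
      ∑ i, ∑ j, conjDiag W μ i j ^ 2 / ((lam i + lam j) / 2 + s)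
        - 2 * ∑ i, ∑ j, conjDiag W μ i j * conjDiag W z i j +
        ∑ i, ∑ j, ((lam i + lam j) / 2 + s) * conjDiag W z i j ^ 2 := by
    rw [mul_sum, ← sum_sub_distrib, ← sum_add_distrib]
    refine sum_congr rfl fun i _ => ?_
    rw [mul_sum, ← sum_sub_distrib, ← sum_add_distrib]
    refine sum_congr rfl fun j _ => ?_
    set q := (lam i + lam j) / 2 + s with hq
    have hqq : q * q⁻¹ = 1 := mul_inv_cancel₀ (hm i j).ne'
    rw [div_eq_mul_inv, div_eq_mul_inv]
    linear_combination (conjDiag W μ i j ^ 2 * q⁻¹ - 2 * conjDiag W μ i j * conjDiag W z i j) * hqq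
  -- Σ bZ = Σ μ z ; Σ (m+s) Z² = Σ c z²
  have hA : ∑ i, ∑ j, conjDiag W μ i j * conjDiag W z i j = ∑ k, μ k * z k :=
    sum_conjDiag_mul_conjDiag hW μ z
  have hsymm : ∑ i, ∑ j, lam j * conjDiag W z i j ^ 2 = ∑ i, ∑ j, lam i * conjDiag W z i j ^ 2 := by
    rw [sum_comm]
    refine sum_congr rfl fun i _ => sum_congr rfl fun j _ => ?_
    rw [← conjDiag_transpose W z, transpose_apply, conjDiag_transpose]
  have hB : ∑ i, ∑ j, ((lam i + lam j) / 2 + s) * conjDiag W z i j ^ 2 = ∑ k, c k * z k ^ 2 := by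
    have e1 : ∑ i, ∑ j, ((lam i + lam j) / 2 + s) * conjDiag W z i j ^ 2 =
        (1 / 2) * ∑ i, ∑ j, (lam i + s) * conjDiag W z i j ^ 2 +
          (1 / 2) * ∑ i, ∑ j, lam j * conjDiag W z i j ^ 2 +
          (1 / 2) * ∑ i, ∑ j, s * conjDiag W z i j ^ 2 := by
      rw [mul_sum, mul_sum, mul_sum, ← sum_add_distrib, ← sum_add_distrib]
      refine sum_congr rfl fun i _ => ?_
      rw [mul_sum, mul_sum, mul_sum, ← sum_add_distrib, ← sum_add_distrib]
      refine sum_congr rfl fun j _ => ?_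
      ring
    have e2 : ∑ i, ∑ j, (lam i + s) * conjDiag W z i j ^ 2 =
        ∑ i, ∑ j, lam i * conjDiag W z i j ^ 2 + ∑ i, ∑ j, s * conjDiag W z i j ^ 2 := by
      rw [← sum_add_distrib]
      refine sum_congr rfl fun i _ => ?_
      rw [← sum_add_distrib]
      refine sum_congr rfl fun j _ => ?_
      ring
    have e3 : ∑ i, ∑ j, (lam i + s) * conjDiag W z i j ^ 2 = ∑ k, c k * z k ^ 2 := by
      rw [sum_weight_conjDiag_sq hW lam z s]
      refine sum_congr rfl fun k _ => ?_
      rw [hc]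
    linarith [e1, e2, e3, hsymm]
  rw [hexp, hA, hB] at hpos
  have hfinal : ∀ k, 2 * (μ k * z k) - c k * z k ^ 2 = μ k ^ 2 / c k := fun k => by
    have hck := (hcpos k).ne'
    rw [hz]
    field_simp
    ring
  have hsum : 2 * ∑ k, μ k * z k - ∑ k, c k * z k ^ 2 = ∑ k, μ k ^ 2 / c k := by
    rw [mul_sum, ← sum_sub_distrib]
    exact sum_congr rfl fun k _ => hfinal k
  calc ∑ k, μ k ^ 2 / (avgDiag W lam k + s) = ∑ k, μ k ^ 2 / c k :=
        sum_congr rfl fun k _ => by rw [hc]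
    _ ≤ _ := by linarith


/-! ### `Tr |M|^p` and its eigenbasis bookkeeping -/

section TrAbsPow

variable {n : Type*} [Fintype n] [DecidableEq n]

/-- `S_p(M) = Tr |M|^p` for a real (symmetric) matrix, via the continuous functional calculus; equals
`Σ_k |λ_k(M)|^p` (`trAbsPow_eq_sum`) — the `p`-th power of the unnormalised Schatten `p`-norm.
[cite: BallCarlenLieb1994, §1 (the norms `‖A‖_p = (Tr (A*A)^{p/2})^{1/p}`)] -/
def trAbsPow (p : ℝ) (M : Matrix n n ℝ) : ℝ := (cfc (fun x : ℝ => |x| ^ p) M).trace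

/-- `Tr |M|^p = Σ_k |λ_k(M)|^p`. [cite: BallCarlenLieb1994, §1] -/
theorem trAbsPow_eq_sum (p : ℝ) {M : Matrix n n ℝ} (hM : M.IsHermitian) :
    trAbsPow p M = ∑ k, |hM.eigenvalues k| ^ p := by
  have h := Literature.Analysis.Matrix.TraceJensen.re_trace_cfc_eq_sum_eigenvalues hM
    (fun x : ℝ => |x| ^ p)
  simpa [trAbsPow] using h

/-- `Tr |M|^p ≥ 0`. [cite: BallCarlenLieb1994, §1] -/
theorem trAbsPow_nonneg (p : ℝ) {M : Matrix n n ℝ} (hM : M.IsHermitian) : 0 ≤ trAbsPow p M := by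
  rw [trAbsPow_eq_sum p hM]
  exact sum_nonneg fun k _ => Real.rpow_nonneg (abs_nonneg _) _

omit [Fintype n] in
/-- `diag(d)` is Hermitian (real entries). [folklore] -/
private theorem isHermitian_diagonal_real (d : n → ℝ) : (diagonal d).IsHermitian :=
  isHermitian_diagonal_of_self_adjoint _ (IsSelfAdjoint.all _)

/-- The multispectrum of `diag(d)` is `d`: `Σ_k g(λ_k(diag d)) = Σ_i g(d_i)`.
[cite: BallCarlenLieb1994, §1 (bookkeeping)] -/
theorem sum_eigenvalues_diagonal (d : n → ℝ) (g : ℝ → ℝ) :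
    ∑ k, g ((isHermitian_diagonal_real d).eigenvalues k) = ∑ i, g (d i) := by
  have hr := (isHermitian_diagonal_real d).roots_charpoly_eq_eigenvalues
  rw [charpoly_diagonal] at hr
  have hprod : (∏ i, (Polynomial.X - Polynomial.C (d i))) =
      ((univ.val.map d).map fun a => Polynomial.X - Polynomial.C a).prod := by
    rw [Finset.prod_eq_multiset_prod, Multiset.map_map]; rfl
  rw [hprod, Polynomial.roots_multiset_prod_X_sub_C] at hr
  have h2 := congrArg (fun s : Multiset ℝ => (s.map g).sum) hr
  simp only [Multiset.map_map, Function.comp_def, RCLike.ofReal_real_eq_id, id_eq] at h2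
  rw [Finset.sum_eq_multiset_sum, Finset.sum_eq_multiset_sum]
  exact h2.symm

/-- Each eigenvalue of `diag(d)` is one of the `d_i`. [cite: BallCarlenLieb1994, §1 (bookkeeping)] -/
theorem eigenvalues_diagonal_mem (d : n → ℝ) {D : Set ℝ} (hD : ∀ i, d i ∈ D) (k : n) :
    (isHermitian_diagonal_real d).eigenvalues k ∈ D := by
  have hr := (isHermitian_diagonal_real d).roots_charpoly_eq_eigenvalues
  rw [charpoly_diagonal] at hr
  have hprod : (∏ i, (Polynomial.X - Polynomial.C (d i))) =
      ((univ.val.map d).map fun a => Polynomial.X - Polynomial.C a).prod := by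
    rw [Finset.prod_eq_multiset_prod, Multiset.map_map]; rfl
  rw [hprod, Polynomial.roots_multiset_prod_X_sub_C] at hr
  have hmem : (RCLike.ofReal ((isHermitian_diagonal_real d).eigenvalues k) : ℝ) ∈
      Multiset.map (RCLike.ofReal ∘ (isHermitian_diagonal_real d).eigenvalues) univ.val :=
    Multiset.mem_map_of_mem _ (mem_univ_val k)
  rw [← hr] at hmem
  obtain ⟨i, -, hi⟩ := Multiset.mem_map.1 hmem
  have : d i = (isHermitian_diagonal_real d).eigenvalues k := by simpa using hi
  rw [← this]; exact hD i

/-- `Tr |diag(d)|^p = Σ_i |d_i|^p`. [cite: BallCarlenLieb1994, §1] -/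
theorem trAbsPow_diagonal (p : ℝ) (d : n → ℝ) : trAbsPow p (diagonal d) = ∑ i, |d i| ^ p := by
  rw [trAbsPow_eq_sum p (isHermitian_diagonal_real d)]
  exact sum_eigenvalues_diagonal d (fun x => |x| ^ p)

omit [Fintype n] [DecidableEq n] in
/-- Over `ℝ` the conjugate transpose is the transpose. [folklore] -/
private theorem conjTranspose_eq_transpose_real (W : Matrix n n ℝ) : Wᴴ = Wᵀ := by
  ext i j; rfl

/-- A real orthogonal matrix from the unitary group: `Wᵀ W = 1`. [folklore] -/
private theorem transpose_mul_self_of_mem_unitary {W : Matrix n n ℝ} (hW : W ∈ Matrix.unitaryGroup n ℝ) :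
    Wᵀ * W = 1 := by
  have h := Unitary.star_mul_self_of_mem hW
  rwa [star_eq_conjTranspose, conjTranspose_eq_transpose_real] at h

/-- The spectral decomposition of a real symmetric matrix as `b = W diag(μ) Wᵀ` with `W` real orthogonal
(Mathlib's spectral theorem). [cite: BallCarlenLieb1994, §1 (bookkeeping)] -/
theorem eq_conjDiag_eigenvectorUnitary {b : Matrix n n ℝ} (hb : b.IsHermitian) :
    b = conjDiag (hb.eigenvectorUnitary : Matrix n n ℝ) hb.eigenvalues := by
  have h := Literature.Analysis.Matrix.TraceJensen.eq_conj_diagonal hb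
  rw [conjTranspose_eq_transpose_real] at h
  unfold conjDiag
  convert h using 3
  ext i j
  rw [diagonal_apply, diagonal_apply]
  rfl

/-- **(K3a) the diagonal is dominated by the spectrum**: for `W` real orthogonal and `p ≥ 1`,
`Σ_k (Σ_i W_ik² λ_i)^p ≤ Σ_i λ_i^p` for `λ_i > 0` (Peierls–Jensen in the basis `W` for `diag λ`).
[cite: RicardXu2016, proof of Lemma 5 ("by the contractivity of 𝓔 on L_p": ‖𝓔_b(a)‖_p ≤ ‖a‖_p)] -/
theorem sum_avgDiag_rpow_le {W : Matrix n n ℝ} (hW : W ∈ Matrix.unitaryGroup n ℝ) (lam : n → ℝ)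
    (hlam : ∀ i, 0 < lam i) {p : ℝ} (hp : 1 ≤ p) :
    ∑ k, avgDiag W lam k ^ p ≤ ∑ i, lam i ^ p := by
  have hconv : ConvexOn ℝ (Set.Ici (0:ℝ)) (fun x : ℝ => x ^ p) := convexOn_rpow hp
  have hD : ∀ k, (isHermitian_diagonal_real lam).eigenvalues k ∈ Set.Ici (0:ℝ) :=
    eigenvalues_diagonal_mem lam (fun i => (hlam i).le)
  have hU : (W : Matrix n n ℝ) ∈ unitary (Matrix n n ℝ) := hW
  have hPJ := Literature.Analysis.Matrix.TraceJensen.sum_peierls_jensen_le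
    (isHermitian_diagonal_real lam) hconv hD hU
  -- identify both sides
  have hdiag : ∀ k, RCLike.re ((Wᴴ * diagonal lam * W) k k) = avgDiag W lam k := by
    intro k
    rw [conjTranspose_eq_transpose_real, RCLike.re_to_real, mul_apply]
    unfold avgDiag
    refine sum_congr rfl fun i _ => ?_
    rw [mul_diagonal, transpose_apply]; ring
  have htr : RCLike.re ((cfc (fun x : ℝ => x ^ p) (diagonal lam)).trace) = ∑ i, lam i ^ p := by
    rw [Literature.Analysis.Matrix.TraceJensen.re_trace_cfc_eq_sum_eigenvalues
      (isHermitian_diagonal_real lam)]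
    exact sum_eigenvalues_diagonal lam (fun x => x ^ p)
  simp_rw [hdiag] at hPJ
  rwa [htr] at hPJ

end TrAbsPow

/-! ### (K2) The compression step, integrated -/

section CompressRpow

variable {n : Type*} [Fintype n] [DecidableEq n]

/-- **(K2)** For `W` with `Wᵀ W = 1`, `λ_i > 0`, `0 < β < 1`:
`Σ_k ã_k^{−β} μ_k² ≤ Σ_{ij} ((λ_i+λ_j)/2)^{−β} b_{ij}²` with `b = W diag(μ) Wᵀ`, `ã_k = Σ_i W_ik² λ_i` —
the resolvent inequality `resolvent_compress` integrated against `C_β⁻¹ s^{−β} ds`.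
[cite: RicardXu2016, proof of Lemma 5 (eq. (df2): ψ''(0) ≥ ψ̃''(0) for ã = 𝓔_b(a))] -/
theorem compress_rpow {W : Matrix n n ℝ} (hW : Wᵀ * W = 1) {lam : n → ℝ} (hlam : ∀ i, 0 < lam i)
    (μ : n → ℝ) {β : ℝ} (hβ0 : 0 < β) (hβ1 : β < 1) :
    ∑ k, avgDiag W lam k ^ (-β) * μ k ^ 2 ≤
      ∑ i, ∑ j, ((lam i + lam j) / 2) ^ (-β) * conjDiag W μ i j ^ 2 := by
  have hC := stC_pos hβ0 hβ1
  have hm : ∀ i j, 0 < (lam i + lam j) / 2 := fun i j => by have := hlam i; have := hlam j; positivity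
  have ha : ∀ k, 0 < avgDiag W lam k := fun k => avgDiag_pos hW hlam k
  -- rewrite both sides as integrals
  have hL : ∀ k, avgDiag W lam k ^ (-β) * μ k ^ 2 =
      (stC β)⁻¹ * ∫ s in Set.Ioi (0:ℝ), μ k ^ 2 * (s ^ (-β) / (avgDiag W lam k + s)) := by
    intro k
    rw [integral_const_mul, integral_kernel (ha k)]
    field_simp
  have hR : ∀ i j, ((lam i + lam j) / 2) ^ (-β) * conjDiag W μ i j ^ 2 =
      (stC β)⁻¹ * ∫ s in Set.Ioi (0:ℝ), conjDiag W μ i j ^ 2 * (s ^ (-β) / ((lam i + lam j) / 2 + s)) := by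
    intro i j
    rw [integral_const_mul, integral_kernel (hm i j)]
    field_simp
  have hintL : ∀ k, IntegrableOn (fun s : ℝ => μ k ^ 2 * (s ^ (-β) / (avgDiag W lam k + s))) (Set.Ioi 0) :=
    fun k => (integrableOn_kernel hβ0 hβ1 (ha k)).const_mul _
  have hintR : ∀ i j, IntegrableOn
      (fun s : ℝ => conjDiag W μ i j ^ 2 * (s ^ (-β) / ((lam i + lam j) / 2 + s))) (Set.Ioi 0) :=
    fun i j => (integrableOn_kernel hβ0 hβ1 (hm i j)).const_mul _
  have hintRi : ∀ i, IntegrableOn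
      (fun s : ℝ => ∑ j, conjDiag W μ i j ^ 2 * (s ^ (-β) / ((lam i + lam j) / 2 + s))) (Set.Ioi 0) :=
    fun i => integrable_finsetSum _ (fun j _ => hintR i j)
  have e1 : ∑ k, avgDiag W lam k ^ (-β) * μ k ^ 2 =
      (stC β)⁻¹ * ∫ s in Set.Ioi (0:ℝ), ∑ k, μ k ^ 2 * (s ^ (-β) / (avgDiag W lam k + s)) := by
    rw [integral_finsetSum _ (fun k _ => hintL k), mul_sum]
    exact sum_congr rfl fun k _ => hL k
  have e2 : ∑ i, ∑ j, ((lam i + lam j) / 2) ^ (-β) * conjDiag W μ i j ^ 2 =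
      (stC β)⁻¹ * ∫ s in Set.Ioi (0:ℝ), ∑ i, ∑ j,
        conjDiag W μ i j ^ 2 * (s ^ (-β) / ((lam i + lam j) / 2 + s)) := by
    rw [integral_finsetSum _ (fun i _ => hintRi i), mul_sum]
    refine sum_congr rfl fun i _ => ?_
    rw [integral_finsetSum _ (fun j _ => hintR i j), mul_sum]
    exact sum_congr rfl fun j _ => hR i j
  rw [e1, e2]
  refine mul_le_mul_of_nonneg_left ?_ (inv_nonneg.2 hC.le)
  refine setIntegral_mono_on (integrable_finsetSum _ (fun k _ => hintL k))
    (integrable_finsetSum _ (fun i _ => hintRi i)) measurableSet_Ioi fun s hs => ?_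
  have hs0 : (0:ℝ) < s := hs
  have hsp : 0 ≤ s ^ (-β) := Real.rpow_nonneg hs0.le _
  have key := resolvent_compress hW hlam μ hs0.le
  have eL : ∑ k, μ k ^ 2 * (s ^ (-β) / (avgDiag W lam k + s)) =
      s ^ (-β) * ∑ k, μ k ^ 2 / (avgDiag W lam k + s) := by
    rw [mul_sum]; refine sum_congr rfl fun k _ => ?_; ring
  have eR : ∑ i, ∑ j, conjDiag W μ i j ^ 2 * (s ^ (-β) / ((lam i + lam j) / 2 + s)) =
      s ^ (-β) * ∑ i, ∑ j, conjDiag W μ i j ^ 2 / ((lam i + lam j) / 2 + s) := by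
    rw [mul_sum]; refine sum_congr rfl fun i _ => ?_
    rw [mul_sum]; refine sum_congr rfl fun j _ => ?_; ring
  rw [eL, eR]
  exact mul_le_mul_of_nonneg_left key hsp

end CompressRpow

/-! ### (K3) Hölder, and the key inequality -/

section Key

variable {n : Type*} [Fintype n] [DecidableEq n]

omit [DecidableEq n] in
/-- **(K3) reverse Hölder**: for `c_k > 0` and `1 < p < 2`,
`(Σ_k |μ_k|^p)^{2/p} (Σ_k c_k^p)^{(p−2)/p} ≤ Σ_k c_k^{p−2} μ_k²`
(Hölder with exponents `2/p` and `2/(2−p)` applied to `|μ_k|^p = (c_k^{p−2}μ_k²)^{p/2} · c_k^{(2−p)p/2}`).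
[cite: RicardXu2016, proof of Lemma 5 (last display: "by (df2) and the Hölder inequality")] -/
theorem holder_step (c μ : n → ℝ) (hc : ∀ k, 0 < c k) {p : ℝ} (hp1 : 1 < p) (hp2 : p < 2)
    (hne : (univ : Finset n).Nonempty) :
    (∑ k, |μ k| ^ p) ^ (2 / p) * (∑ k, c k ^ p) ^ ((p - 2) / p) ≤ ∑ k, c k ^ (p - 2) * μ k ^ 2 := by
  have hp0 : 0 < p := by linarith
  have h2p : 0 < 2 - p := by linarith
  -- Hölder exponents P = 2/p, Q = 2/(2-p)
  have hPQ : (2 / p).HolderConjugate (2 / (2 - p)) := by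
    rw [Real.holderConjugate_iff]
    refine ⟨by rw [lt_div_iff₀ hp0]; linarith, ?_⟩
    field_simp; ring
  obtain ⟨f, hf⟩ : ∃ f : n → ℝ, ∀ k, f k = (c k ^ (p - 2) * μ k ^ 2) ^ (p / 2) := ⟨_, fun k => rfl⟩
  obtain ⟨g, hg⟩ : ∃ g : n → ℝ, ∀ k, g k = c k ^ ((2 - p) * p / 2) := ⟨_, fun k => rfl⟩
  have hcm : ∀ k, 0 ≤ c k ^ (p - 2) * μ k ^ 2 := fun k =>
    mul_nonneg (Real.rpow_nonneg (hc k).le _) (sq_nonneg _)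
  have hf0 : ∀ k, 0 ≤ f k := fun k => by rw [hf]; exact Real.rpow_nonneg (hcm k) _
  have hg0 : ∀ k, 0 ≤ g k := fun k => by rw [hg]; exact Real.rpow_nonneg (hc k).le _
  have hH := Real.inner_le_Lp_mul_Lq univ f g hPQ
  -- f g = |μ|^p
  have hfg : ∀ k, f k * g k = |μ k| ^ p := by
    intro k
    rw [hf, hg, Real.mul_rpow (Real.rpow_nonneg (hc k).le _) (sq_nonneg _), ← Real.rpow_mul (hc k).le,
      show μ k ^ 2 = |μ k| ^ (2:ℝ) by rw [← sq_abs, Real.rpow_two], ← Real.rpow_mul (abs_nonneg _)]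
    have e2 : (2:ℝ) * (p / 2) = p := by ring
    rw [e2, mul_assoc, mul_comm (|μ k| ^ p), ← mul_assoc, ← Real.rpow_add (hc k)]
    have e1 : (p - 2) * (p / 2) + (2 - p) * p / 2 = 0 := by ring
    rw [e1, Real.rpow_zero, one_mul]
  -- |f|^P = c^{p-2} μ², |g|^Q = c^p
  have hfP : ∀ k, |f k| ^ (2 / p) = c k ^ (p - 2) * μ k ^ 2 := by
    intro k
    rw [abs_of_nonneg (hf0 k), hf, ← Real.rpow_mul (hcm k), show p / 2 * (2 / p) = 1 by field_simp,
      Real.rpow_one]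
  have hgQ : ∀ k, |g k| ^ (2 / (2 - p)) = c k ^ p := by
    intro k
    rw [abs_of_nonneg (hg0 k), hg, ← Real.rpow_mul (hc k).le]
    congr 1; field_simp
  simp_rw [hfg, hfP, hgQ] at hH
  -- hH : Σ |μ|^p ≤ (Σ c^{p-2}μ²)^{1/(2/p)} (Σ c^p)^{1/(2/(2-p))}
  have hS : 0 < ∑ k, c k ^ p := by
    obtain ⟨k, hk⟩ := hne
    exact lt_of_lt_of_le (Real.rpow_pos_of_pos (hc k) p)
      (single_le_sum (f := fun k => c k ^ p) (fun k _ => (Real.rpow_nonneg (hc k).le p)) hk)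
  have hA0 : 0 ≤ ∑ k, c k ^ (p - 2) * μ k ^ 2 := sum_nonneg fun k _ => hcm k
  have hM0 : 0 ≤ ∑ k, |μ k| ^ p := sum_nonneg fun k _ => Real.rpow_nonneg (abs_nonneg _) _
  -- raise to the power 2/p
  have h1 : (∑ k, |μ k| ^ p) ^ (2 / p) ≤
      ((∑ k, c k ^ (p - 2) * μ k ^ 2) ^ (1 / (2 / p)) * (∑ k, c k ^ p) ^ (1 / (2 / (2 - p)))) ^ (2 / p) :=
    Real.rpow_le_rpow hM0 hH (by positivity)
  rw [Real.mul_rpow (Real.rpow_nonneg hA0 _) (Real.rpow_nonneg hS.le _), ← Real.rpow_mul hA0,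
    ← Real.rpow_mul hS.le, show 1 / (2 / p) * (2 / p) = 1 by field_simp, Real.rpow_one,
    show 1 / (2 / (2 - p)) * (2 / p) = (2 - p) / p by field_simp] at h1
  -- multiply by (Σ c^p)^{(p-2)/p}
  have hinv : (∑ k, c k ^ p) ^ ((2 - p) / p) * (∑ k, c k ^ p) ^ ((p - 2) / p) = 1 := by
    rw [← Real.rpow_add hS, show (2 - p) / p + (p - 2) / p = 0 by ring, Real.rpow_zero]
  calc (∑ k, |μ k| ^ p) ^ (2 / p) * (∑ k, c k ^ p) ^ ((p - 2) / p)
      ≤ ((∑ k, c k ^ (p - 2) * μ k ^ 2) * (∑ k, c k ^ p) ^ ((2 - p) / p)) *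
          (∑ k, c k ^ p) ^ ((p - 2) / p) :=
        mul_le_mul_of_nonneg_right h1 (Real.rpow_nonneg hS.le _)
    _ = ∑ k, c k ^ (p - 2) * μ k ^ 2 := by rw [mul_assoc, hinv, mul_one]

/-- **THE KEY INEQUALITY** (real symmetric case of [RicardXu2016, Lemma 5, (df1)] =
[Zhang2020Schatten, §3 (ineq:key)] in the eigenbasis of `a = diag(λ)`): for `1 < p < 2`, `λ_i ≠ 0` and a
real symmetric `b`,
`p(p−1) (Σ_i |λ_i|^p)^{(p−2)/p} (Tr |b|^p)^{2/p} ≤ Σ_{i,j} dd p λ_i λ_j · b_{ij}²`,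
i.e. `ψ''(0) ≥ p(p−1)‖a‖_p^{p−2}‖b‖_p²` for `ψ(t) = Tr|a+tb|^p`. Chain: (K0) `λ ↦ |λ|`, (K1)
Hermite–Hadamard, (K2) compression in the eigenbasis of `b`, (K3) Hölder and `Σ ã_k^p ≤ Σ |λ_i|^p`.
[cite: RicardXu2016, Lemma 5] [cite: Zhang2020Schatten, Lemma 2.2 and §3] [cite: BallCarlenLieb1994, Thm. 1 (proof, §II)] -/
theorem key_inequality [Nonempty n] (lam : n → ℝ) (hlam : ∀ i, lam i ≠ 0) {b : Matrix n n ℝ}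
    (hb : b.IsHermitian) {p : ℝ} (hp1 : 1 < p) (hp2 : p < 2) :
    p * (p - 1) * (∑ i, |lam i| ^ p) ^ ((p - 2) / p) * trAbsPow p b ^ (2 / p) ≤
      ∑ i, ∑ j, dd p (lam i) (lam j) * b i j ^ 2 := by
  have hp0 : 0 < p := by linarith
  have hpp : 0 ≤ p * (p - 1) := by nlinarith
  obtain ⟨al, hal⟩ : ∃ al : n → ℝ, ∀ i, al i = |lam i| := ⟨_, fun i => rfl⟩
  have hal0 : ∀ i, 0 < al i := fun i => by rw [hal]; exact abs_pos.2 (hlam i)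
  -- spectral decomposition of b
  set W : Matrix n n ℝ := (hb.eigenvectorUnitary : Matrix n n ℝ) with hWdef
  set μ : n → ℝ := hb.eigenvalues with hμ
  have hWu : W ∈ Matrix.unitaryGroup n ℝ := hb.eigenvectorUnitary.prop
  have hW : Wᵀ * W = 1 := transpose_mul_self_of_mem_unitary hWu
  have hbW : b = conjDiag W μ := eq_conjDiag_eigenvectorUnitary hb
  -- (K0) + (K1): termwise
  have step1 : ∑ i, ∑ j, p * (p - 1) * ((al i + al j) / 2) ^ (p - 2) * b i j ^ 2 ≤
      ∑ i, ∑ j, dd p (lam i) (lam j) * b i j ^ 2 := by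
    refine sum_le_sum fun i _ => sum_le_sum fun j _ => mul_le_mul_of_nonneg_right ?_ (sq_nonneg _)
    have hK0 : dd p (al i) (al j) ≤ dd p (lam i) (lam j) := by
      rw [hal, hal]; exact dd_abs_le hp1 hp2.le (hlam i) (hlam j)
    exact (hh_dd hp1 hp2.le (hal0 i) (hal0 j)).trans hK0
  -- (K2)
  have step2 := compress_rpow hW hal0 μ (β := 2 - p) (by linarith) (by linarith)
  have e2 : ∀ i j, ((al i + al j) / 2) ^ (p - 2) = ((al i + al j) / 2) ^ (-(2 - p)) := by
    intro i j; congr 1; ring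
  -- (K3)
  have step3 := holder_step (fun k => avgDiag W al k) μ (fun k => avgDiag_pos hW hal0 k) hp1 hp2
    univ_nonempty
  have step4 : ∑ k, avgDiag W al k ^ p ≤ ∑ i, al i ^ p := sum_avgDiag_rpow_le hWu al hal0 hp1.le
  have hS : 0 < ∑ k, avgDiag W al k ^ p :=
    lt_of_lt_of_le (Real.rpow_pos_of_pos (avgDiag_pos hW hal0 (Classical.arbitrary n)) p)
      (single_le_sum (f := fun k => avgDiag W al k ^ p)
        (fun k _ => Real.rpow_nonneg (avgDiag_pos hW hal0 k).le p) (mem_univ _))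
  have step4' : (∑ i, al i ^ p) ^ ((p - 2) / p) ≤ (∑ k, avgDiag W al k ^ p) ^ ((p - 2) / p) :=
    Real.rpow_le_rpow_of_nonpos hS step4 (div_nonpos_of_nonpos_of_nonneg (by linarith) hp0.le)
  have htr : trAbsPow p b = ∑ k, |μ k| ^ p := trAbsPow_eq_sum p hb
  have hlam_al : ∑ i, |lam i| ^ p = ∑ i, al i ^ p := sum_congr rfl fun i _ => by rw [hal]
  have hM0 : 0 ≤ (∑ k, |μ k| ^ p) ^ (2 / p) :=
    Real.rpow_nonneg (sum_nonneg fun k _ => Real.rpow_nonneg (abs_nonneg _) _) _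
  calc p * (p - 1) * (∑ i, |lam i| ^ p) ^ ((p - 2) / p) * trAbsPow p b ^ (2 / p)
      = p * (p - 1) * ((∑ k, |μ k| ^ p) ^ (2 / p) * (∑ i, al i ^ p) ^ ((p - 2) / p)) := by
        rw [htr, hlam_al]; ring
    _ ≤ p * (p - 1) * ((∑ k, |μ k| ^ p) ^ (2 / p) * (∑ k, avgDiag W al k ^ p) ^ ((p - 2) / p)) :=
        mul_le_mul_of_nonneg_left (mul_le_mul_of_nonneg_left step4' hM0) hpp
    _ ≤ p * (p - 1) * ∑ k, avgDiag W al k ^ (p - 2) * μ k ^ 2 :=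
        mul_le_mul_of_nonneg_left step3 hpp
    _ = p * (p - 1) * ∑ k, avgDiag W al k ^ (-(2 - p)) * μ k ^ 2 := by
        congr 1; refine sum_congr rfl fun k _ => ?_; rw [show p - 2 = -(2 - p) by ring]
    _ ≤ p * (p - 1) * ∑ i, ∑ j, ((al i + al j) / 2) ^ (-(2 - p)) * conjDiag W μ i j ^ 2 :=
        mul_le_mul_of_nonneg_left step2 hpp
    _ = ∑ i, ∑ j, p * (p - 1) * ((al i + al j) / 2) ^ (p - 2) * b i j ^ 2 := by
        rw [mul_sum]; refine sum_congr rfl fun i _ => ?_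
        rw [mul_sum]; refine sum_congr rfl fun j _ => ?_
        rw [← hbW, e2]; ring
    _ ≤ ∑ i, ∑ j, dd p (lam i) (lam j) * b i j ^ 2 := step1

end Key

end Literature.Analysis.Matrix.BallCarlenLieb
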